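import Literature.MathematicalPhysics.QuantumFieldTheory.Balaban1983to89.B3Ineq25Op116RegularTorus
import Literature.MathematicalPhysics.QuantumFieldTheory.Balaban1983to89.B3Op116KernelRegularTorusDecay
import Literature.MathematicalPhysics.QuantumFieldTheory.Balaban1983to89.B3Op116BoxRows
import Literature.MathematicalPhysics.QuantumFieldTheory.Balaban1983to89.B3Op116HolderKernelRegularRegion
import Literature.MathematicalPhysics.QuantumFieldTheory.Balaban1983to89.B3Op116MixedKernelRegularRegion

/-!
# Bałaban, *(Higgs)₂,₃ quantum fields in a finite volume III. Renormalization* [B3] — inequality (2.5) p. 424, THE (1.16) ALTERNATIVE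
`‖h(1.16)_{n,n′}h′‖_{1,α} ≤ O((e(L^kε)p(L^kε))^{n+n′})e^{−δ₀dist(supp h,supp h′)}` ON A REGION `Ω ⊆ T_ε` — print's generality
«G_k(Ω,B̃)», «G_k(Ω,Ã+B̃)» — FROM THE (2.10)/(2.11) PROPAGATOR INPUTS AT INTERIOR POINTS (file R5(B) `ineq25At_op116_regularRegion`), AND
HYPOTHESIS-FREE UNDER PRINT'S REGIME (file R5(C) `ineq25At_op116_region`): the region assembly of B3-CLOSURE §5 item 20

statement-level skeleton of published theorems with citation tags; proofs where landed; nothing here is a claim about the Yang–Mills mass gap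

T. Bałaban, Commun. Math. Phys. **88** (1983) 411–445 [cite: Balaban1983Higgs3]; part I, Commun. Math. Phys. **85** (1982) 603–636
[cite: Balaban1982Higgs1]; [B4] Commun. Math. Phys. **89** (1983) 571–597 [cite: Balaban1983RegularityDecay].  PDFs held:
`paper:balaban1983-higgs-2-3-quantum-fields-finite-volume` (journal page = PDF page + 410; p. 412 = `p0002.txt`, p. 414 = `p0004.txt`,
p. 420 = `p0010.txt`, p. 424 = `p0014.txt`, p. 426 = `p0016.txt`), `paper:balaban1983-cmp89-regularity-decay` (p. 573 = `p0003.txt`).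

CITATION HEADER (lean-in-tree rule).  Cell `lit-balaban` (HOME `run/shared/lean/pub/lit-balaban/`), Phase-2 proof seat **p40** gen 75
(unit `lit-balaban-p40`); TAKING line HOME/STATUS 2026-08-23T09:21Z: **B3-CLOSURE.md §5 item 20** = the REGION twin of the (1.16) branch of
(2.5) (lead g12 word 08:58Z, owner r15 g15 welcome 09:22Z; p35 g23 keeps the Hölder twin = file R3).  SKELETON rows **B3.Eq2.5** (decl of
record `B3Sect2StatementsPart2.ScaledKernels.Ineq25At`) / **B3.Eq1.16** (analytic half), fold owner r15 — a located member; r15's scope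
clause: «(1.16) branch: every nested big-block union `Ω₂ ⊆ Ω ⊆ T_ε` under dist(supp Ã, ∂Ω) > 2r(L^kε) (p. 412), `n, n′ ≥ 1`, `n + n′ > d`;
`Ω = T_ε` instance p358683».  THE REGION PROGRAMME: R1 `B3Op116RegionSources` (p40: `DeepBlk`, the vanishing of the sources off the deep
set, the truncated L-form row), R2 `B3Op116DKernelRegularRegion` (p40: the region state machine, `kernel116_value_le_region`,
`kernel116_deriv_le_region`), R3 `B3Op116HolderKernelRegularRegion` (p35 g23: `kernel116_holder_le_region_of_state`), R4a
`B3Op116MixedSeedRegion` + R4b `B3Op116MixedKernelRegularRegion` (p40: `kernel116_mixed_le_region`), R5 = THIS FILE.  USED BY NAME, never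
restated: p40 g72's general-region assembly `B3Ineq25Op116Smooth.ineq25At_op116_smooth_of_bounds` (the eight kernel binders at `Interior`
points), the four region kernel theorems above, p40 g74's `B3Ineq25Op116RegularTorus.{entry_mono, entry_mono_holder}`, p35's torus CONSTANTS
`valC/derC/holC` and p40's `mixC` with their signs (the region constants ARE the torus constants), and — for R5(C) — the tree's
HYPOTHESIS-FREE REGION theorems: r14/r15/p33's `B3Ineq210RegularRegion.ineq210_regularRegion_small` ((2.10) on r14's region carrier at
interior pairs), p33's `B3Ineq210MixedRegularRegion.ineq210_mixed_regularRegion` (twice-differentiated per-piece (2.10) at interior pairs),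
p35's `B3Op116BoxRows.hcol_le_region` ((2.11) Hölder row at interior points, v1.2), p33 g61's
`B3Ineq25SmoothLocalization.ineq25_smooth_regularNested` (the `δG_k(Ω,Ω₂,B̃)` clause for nested big-block unions), r14's
`B3Op116KernelRegularTorusDecay.ineq210_rate_mono`.

## What is printed (verbatim)

(1.16) p. 414 [PDF 4]: *"in the last term of this expansion, equal to [G_k(Ω,B̃)V_k(Ã,B̃)]^n G_k(Ω,Ã+B̃)[V_k(Ã,B̃)G_k(Ω,B̃)]^{n′}, (1.16) we
have the propagator G_k(Ω,Ã+B̃). … for n, n′ sufficiently large, a kernel of the operator (1.16) is a sufficiently regular function of both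
variables. More exactly the Hölder norms of the covariant derivatives of this kernel, the norms defined for example in the inequalities
(I.2.24) and (I.2.25) of Proposition I.2.1, are exponentially decaying with the distance of the arguments and are uniformly bounded by
O(1)(e(L^kε)^{1−α})^{n+n′}, where α > 0 but can be arbitrarily small. This estimate follows easily from the properties of the propagators
G_k(Ω,A) proved in the next paper."*;  p. 412 [PDF 2]: *"we will assume that |A|, |∂A|, |∂B| … ≤ O(1)p(L^kε) and dist(supp A, ∂Ω) >
2r(L^kε)"*;  (2.5) p. 424 [PDF 14]: *"‖h(an operator δG_k(Ω,Ω₂,B̃) or (1.16))h′‖_{1,α} ≤ O(e^{−δ₀dist(Ω₂,∂Ω)} or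
(e(L^kε)p(L^kε))^{n+n′})e^{−δ₀dist(supp h, supp h′)}, (2.5) where h, h′ are functions giving the localizations of the vertices."*;  [B4]
Theorem p. 573 [PDF 3]: (1.9)/(1.10) for `G_k(Ω,A)` at points with `dist({x,x′},Ωᶜ) ≥ R₀` (all points only for parallelepipeds).

## What this file proves, and how

**`ineq25At_op116_regularRegion`** (R5(B)): for nested regions `Ω₂ ⊆ Ω ⊆ T_ε`, ALL ORDERS `n, n′ ≥ 1` WITH `n + n′ > d`, every
`0 ≤ α < 1`: `(sect2Smooth116 hL1 C Ω Ω₂ A B m² a k K₀ r₀ m c₁ c₂ e_R p_R).Ineq25At n n′ α (min δ_G (δ₁/(4L)^{n+n′+1}))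
(C_G + K(c₁,c₂+2c₁,d,m)(valC(n+n′) + derC(n+n′)) + holC(n+n′−1) + d·m·mixC(n+n′))` — the torus constants VERBATIM — from the (2.10)
bounds of `G_k(Ω,B̃)`, `G_k(Ω,Ã+B̃)` at interior pairs (r15's `Ineq210 δ₁ C` on r14's region carrier `regRegionKernels hL1 C Ω · … K₀`),
their twice-differentiated per-piece form (p33's `mixedTermR` at interior pairs), the (2.11) Hölder row of `G_k(Ω,B̃)` at interior points
(p35's shape), `Ã` small, regular AND SUPPORTED ON DEEP BONDS (`Ã_b ≠ 0 ⇒ DeepBlk b₋ ∧ DeepBlk b₊`, print p. 412), `(L^kε)|e|s ≤ 1`, and p33's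
`δG_k(Ω,Ω₂,B̃)` clause: the eight binders of `ineq25At_op116_smooth_of_bounds` fed by `kernel116_value_le_region` (hV/hV′),
`kernel116_deriv_le_region` (hDv/hDv′), p35's `kernel116_holder_le_region_of_state` with R2's `state_op116_cb_region` (hH/hH′),
`kernel116_mixed_le_region` (hM/hM′); rates and scale factors weakened by `entry_mono`.  **`ineq25At_op116_region`** (R5(C)): the same with
every input DISCHARGED by the tree's hypothesis-free region theorems, under print's regime only: `Ω₂ ⊆ Ω` big-block unions, `B̃`, `Ã+B̃`
(I.2.23)-regular on `Ω` and small (`L^kδ|e| ≤ t`, `L^kδ_B ≤ c|e|`), `Ã` small, regular, supported on deep bonds, charge `e² ≤ E₀`, cube size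
`K₀ ≥ K₀min`, `K₀ ∣ M`, `≥ 3` cubes per direction, `L^kε ≤ 1`, `L^kε ≤ e_Rp_R`.

## Honest scope / declared divergences (F7)

(i) Regions: nested big-block unions `Ω₂ ⊆ Ω ⊆ T_ε` of r14's cube parameter `K₀`; the (1.16) clause is obtained at `Interior k K₀ Ω` points —
which is all the carrier's smooth localization class asks (supports inside the interior of `Ω₂ ⊆ Ω`); nothing is claimed in the `R₀`-collar,
exactly as in [B4] p. 573.  (ii) THE SUPPORT HYPOTHESIS on `Ã` is print's own regime p. 412 «dist(supp Ã, ∂Ω) > 2r(L^kε)» in r14's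
`R₀`-vocabulary (`DeepBlk`): it is what makes every intermediate point of the chains (1.16) interior (G-B3-16 in the cell's GAPS register:
a located reading, resolved inside print).  (iii) `(e_Rp_R)^{n+n′}` is read as any `e_Rp_R ≥ L^kε`; the coupling powers live in the explicit
constants `valC/derC/holC/mixC` (not simplified).  (iv) `α < 1` strictly, `n, n′ ≥ 1`; print's `(e(L^kε))^{(1−α)(n+n′)}` bookkeeping not
reproduced.  (v) Rates not optimized.  (vi) In R5(C) the regime is the conjunction of the suppliers' regimes; the regularity of `Ã` on the whole
lattice is assumed besides that of `B̃`, `Ã+B̃` on `Ω`.  No `def`, no new named fact, no `sorry`; axioms standard.  Value = the assembled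
located estimate (2.5), (1.16)-alternative, of B3 §2 at print's generality (regions) — NOT summit progress and nothing about the Yang–Mills
mass gap.
-/

noncomputable section

open scoped BigOperators

namespace Literature.MathematicalPhysics.QuantumFieldTheory.Balaban1983to89.B3Ineq25Op116RegularRegion

open HiggsLattice (ChargeData ScalarField covDeriv)
open HiggsCovariance (propagatorK E)
open B1Eq230FluctCov (Ix cb)
open B1TorusChainTransport (hol)
open B1TorusCubeCover (half)
open B1TorusRegionHSizes (IsBigBlockUnion)
open B3Ineq210RegularRegion (regRegionKernels Interior ineq210_regularRegion_small)
open B3Ineq210MixedRegularRegion (mixedTermR ineq210_mixed_regularRegion)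
open B3Ineq211RegularTorus (IsAdm)
open B3Ineq25SmoothLocalization (sect2DeltaSmooth ineq25_smooth_regularNested)
open B3Ineq31SmoothLocalization (smoothConst)
open B3Ineq25Op116Smooth (sect2Smooth116 ineq25At_op116_smooth_of_bounds)
open B3Ineq25Op116RegularTorus (entry_mono entry_mono_holder)
open B3Op116DKernelRegularTorus (valC derC valC_nonneg derC_nonneg rateAt rateAt_closed cK1)
open B3Op116DKernelRegularRegion (kernel116_value_le_region kernel116_deriv_le_region state_op116_cb_region)
open B3Op116HolderKernelRegularTorus (holC holC_nonneg)
open B3Op116HolderKernelRegularRegion (kernel116_holder_le_region_of_state)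
open B3Op116MixedKernelRegularTorus (mixC mixC_nonneg mixRate_eq dipRate cvDip cdDip)
open B3Op116MixedKernelRegularRegion (kernel116_mixed_le_region)
open B3Op116KernelRegularTorusDecay (ineq210_rate_mono)
open B3Op116BoxRows (hcol_le_region)
open B3Op116RegionSources (DeepBlk)
open B3Ineq210MixedRegularTorus (dip onb)
open B3Eq116TwoSidedExpansion (op116)

variable {P : HiggsLattice.Params} {N : ℕ}

/-! ## §1 (2.5), the (1.16) alternative, on a region for all `n, n′ ≥ 1` with `n + n′ > d`, from the inputs at interior points -/

section Main

variable {k K₀ r₀ m : ℕ} {hL1 : 1 < P.L} {C : ChargeData N} {Ω Ω₂ : Finset (HiggsLattice.Site P 0)} {A B : HiggsLattice.VecField P 0}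
  {msq a : ℝ} {c₁ c₂ eR pR : ℝ} {δ₁ Cst CM s δA cH : ℝ}

set_option maxHeartbeats 800000 in
/-- **INEQUALITY (2.5) OF [B3], THE (1.16) ALTERNATIVE, ON A REGION `Ω ⊆ T_ε`, FOR ALL ORDERS `n, n′ ≥ 1` WITH `n + n′ > d`** (print p. 414
at print's generality «G_k(Ω,B̃)», «G_k(Ω,Ã+B̃)»; p. 424 (2.5)).  Nested `Ω₂ ⊆ Ω`, `L ≥ 2`, `1 ≤ k ≤ K`, `m² > 0`, `a > 0`, `0 ≤ α < 1`:
GIVEN the (2.10) bounds `Ineq210 δ₁ C` (`0 < δ₁ ≤ 1`, `C ≥ 0`) of `G_k(Ω,B̃)` and `G_k(Ω,Ã+B̃)` on r14's region carrier (cube parameter `K₀`,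
interior pairs), their twice-differentiated per-piece form with `C_M ≥ 0` at interior pairs (p33's `mixedTermR` shape), the (2.11) Hölder row
of `G_k(Ω,B̃)` with `c_H ≥ 0` at interior points (p35's shape), `sup_b|Ã_b| ≤ s`, `Ã` (I.2.23)-regular with `δ_A` AND SUPPORTED ON DEEP BONDS
(print p. 412), `(L^kε)|e|s ≤ 1`, bump constants `c₁, c₂ ≥ 0`, `0 ≤ e_Rp_R`, `L^kε ≤ e_Rp_R`, and p33's `δG_k(Ω,Ω₂,B̃)` clause at `(δ_G, C_G)`,
`C_G ≥ 0` — THEN for all `n, n′ ≥ 1` with `d < n + n′`: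
`(sect2Smooth116 hL1 C Ω Ω₂ …).Ineq25At n n′ α (min δ_G (δ₁/(4L)^{n+n′+1})) (C_G + K(c₁,c₂+2c₁,d,m)(valC(n+n′) + derC(n+n′)) + holC(n+n′−1) + d·m·mixC(n+n′))`,
i.e. BOTH clauses of (2.5) at these orders, for every pair of smooth localization functions of the carrier — the torus constants verbatim.
[cite: Balaban1983Higgs3, (2.5) p.424, (1.16) p.414, p.412, (1.32) p.420, (2.10)-(2.11) p.426] [cite: Balaban1982Higgs1, Prop. 2.1 (2.24)-(2.25) p.610, (3.44) p.619] [cite: Balaban1983RegularityDecay, Theorem p.573] -/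
theorem ineq25At_op116_regularRegion (hL2 : 2 ≤ P.L) (hk : 1 ≤ k) (hkK : k ≤ P.K) (hmsq : 0 < msq) (ha : 0 < a) (hΩ : Ω₂ ⊆ Ω)
    (n n' : ℕ) (hn : 1 ≤ n) (hn' : 1 ≤ n') (hd : P.d < n + n')
    {α δG CG : ℝ} (hα0 : 0 ≤ α) (hα1 : α < 1) (hc₁ : 0 ≤ c₁) (hc₂ : 0 ≤ c₂) (ht0 : 0 ≤ eR * pR) (ht : P.mesh k ≤ eR * pR)
    (hCG : 0 ≤ CG) (hδG : (sect2DeltaSmooth hL1 C Ω Ω₂ B msq a k K₀ r₀ m c₁ c₂).Ineq25 α δG CG)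
    (hδ₁ : 0 < δ₁) (hδ₁1 : δ₁ ≤ 1) (hCst : 0 ≤ Cst) (hCM : 0 ≤ CM)
    (h210B : (regRegionKernels hL1 C Ω B msq a k K₀).Ineq210 δ₁ Cst)
    (hmixB : ∀ (j : ℕ) (μ ν : Fin P.d) (x x' : HiggsLattice.Site P 0), Interior k K₀ Ω x → Interior k K₀ Ω x' →
      mixedTermR C Ω B msq a k j μ ν x x' ≤ CM * (P.mesh j ^ P.d)⁻¹ * Real.exp (-(δ₁ * ((HiggsLattice.Site.tdist x x' : ℝ) / (P.L : ℝ) ^ j))))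
    (h210AB : (regRegionKernels hL1 C Ω (A + B) msq a k K₀).Ineq210 δ₁ Cst)
    (hmixAB : ∀ (j : ℕ) (μ ν : Fin P.d) (x x' : HiggsLattice.Site P 0), Interior k K₀ Ω x → Interior k K₀ Ω x' →
      mixedTermR C Ω (A + B) msq a k j μ ν x x'
        ≤ CM * (P.mesh j ^ P.d)⁻¹ * Real.exp (-(δ₁ * ((HiggsLattice.Site.tdist x x' : ℝ) / (P.L : ℝ) ^ j))))
    (i₀ : Ix N) (hs : 0 ≤ s) (hA : ∀ b : HiggsLattice.PBond P 0, |A b| ≤ s) (hδA : 0 ≤ δA)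
    (hregA : ∀ (z : HiggsLattice.Site P 0) (μ ν : Fin P.d), |A ⟨z.shift ν, μ⟩ - A ⟨z, μ⟩| ≤ δA)
    (hAS : ∀ b : HiggsLattice.PBond P 0, A b ≠ 0 → DeepBlk k K₀ Ω b.src ∧ DeepBlk k K₀ Ω b.tgt)
    (ht1 : P.mesh k * (|C.e| * s) ≤ 1) (hcH : 0 ≤ cH)
    (h211 : ∀ (μ : Fin P.d) (x₁ x₂ y : HiggsLattice.Site P 0), Interior k K₀ Ω x₁ → Interior k K₀ Ω x₂ → Interior k K₀ Ω y →
      x₁ ≠ x₂ → ∀ Γ : List (HiggsLattice.Site P 0), IsAdm x₁ x₂ Γ →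
      (∑ i : Ix N, ‖hol C B x₁ Γ (covDeriv C B (propagatorK C Ω B msq a k (cb P N 0 (y, i))) ⟨x₂, μ⟩)
          - covDeriv C B (propagatorK C Ω B msq a k (cb P N 0 (y, i))) ⟨x₁, μ⟩‖)
          / (P.mesh 0 * (HiggsLattice.Site.tdist x₁ x₂ : ℝ)) ^ α
        ≤ ∑ j ∈ Finset.range k, cH * P.mesh j ^ (((1 : ℝ) - α) - (P.d : ℝ)) *
            (Real.exp (-(δ₁ * (P.mesh j)⁻¹ * (P.mesh 0 * (HiggsLattice.Site.tdist x₁ y : ℝ)))) +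
              Real.exp (-(δ₁ * (P.mesh j)⁻¹ * (P.mesh 0 * (HiggsLattice.Site.tdist x₂ y : ℝ)))))) :
    (sect2Smooth116 hL1 C Ω Ω₂ A B msq a k K₀ r₀ m c₁ c₂ eR pR).Ineq25At n n' α
      (min δG (δ₁ / (4 * (P.L : ℝ)) ^ (n + n' + 1)))
      (CG + (smoothConst P.d m c₁ (c₂ + 2 * c₁) *
          (valC P N C k a δ₁ Cst s δA (n + n') + derC P N C k a δ₁ Cst s δA (n + n'))
        + (holC P N C k a δ₁ Cst s δA α cH (n + n' - 1) + P.d * m * mixC P N C k a δ₁ Cst CM s δA (n + n')))) := by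
  have hL : 1 < P.L := hL1
  have hL1r : (1 : ℝ) ≤ (P.L : ℝ) := by exact_mod_cast P.hL
  obtain ⟨m₁, rfl⟩ : ∃ m₁, n = m₁ + 1 := ⟨n - 1, by omega⟩
  obtain ⟨m₂, rfl⟩ : ∃ m₂, n' = m₂ + 1 := ⟨n' - 1, by omega⟩
  set M := m₁ + 1 + (m₂ + 1) with hM
  have hM1 : M - 1 = m₁ + (m₂ + 1) := by omega
  have hM1' : M - 1 + 1 = M := by omega
  have hM12 : M - 1 + 2 = M + 1 := by omega
  -- thresholds
  have hdM : (P.d : ℝ) < (M : ℝ) := by exact_mod_cast hd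
  have hdV : (P.d : ℝ) < ((m₁ + 1 + (m₂ + 1) : ℕ) : ℝ) + 2 := by linarith
  have hdV' : (P.d : ℝ) < ((m₂ + 1 + (m₁ + 1) : ℕ) : ℝ) + 2 := by rw [show m₂ + 1 + (m₁ + 1) = M by omega]; linarith
  have hdD : (P.d : ℝ) < ((m₁ + 1 + (m₂ + 1) : ℕ) : ℝ) + 1 := by linarith
  have hdD' : (P.d : ℝ) < ((m₂ + 1 + (m₁ + 1) : ℕ) : ℝ) + 1 := by rw [show m₂ + 1 + (m₁ + 1) = M by omega]; linarith
  have hdH : (P.d : ℝ) < 1 + ((m₁ + 1 + (m₂ + 1) : ℕ) : ℝ) - α := by linarith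
  have hdH' : (P.d : ℝ) < 1 + ((m₂ + 1 + (m₁ + 1) : ℕ) : ℝ) - α := by rw [show m₂ + 1 + (m₁ + 1) = M by omega]; linarith
  have hd' : P.d < m₂ + 1 + (m₁ + 1) := by omega
  have hdCH : (P.d : ℝ) < 1 + ((M - 1 + 1 : ℕ) : ℝ) - α := by rw [hM1']; linarith
  -- signs of the constants
  have hCV : 0 ≤ valC P N C k a δ₁ Cst s δA M := valC_nonneg hL hδ₁ hCst hs hδA M (by linarith)
  have hCD : 0 ≤ derC P N C k a δ₁ Cst s δA M := derC_nonneg hL hδ₁ hCst hs hδA M (by linarith)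
  have hCH : 0 ≤ holC P N C k a δ₁ Cst s δA α cH (M - 1) := holC_nonneg hL hδ₁ hCst hs hδA hα1 hcH (M - 1) hdCH
  have hCM' : 0 ≤ mixC P N C k a δ₁ Cst CM s δA M := mixC_nonneg hL hδ₁ hCst hCM ha.le hs hδA hd
  -- the common rate
  set δ : ℝ := δ₁ / (4 * (P.L : ℝ)) ^ (M + 1) with hδdef
  have h4L : (1 : ℝ) ≤ 4 * (P.L : ℝ) := by linarith
  have h4L0 : (0 : ℝ) < 4 * (P.L : ℝ) := by linarith
  have hδ0 : 0 ≤ δ := div_nonneg hδ₁.le (pow_nonneg h4L0.le _)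
  have hδU : δ ≤ rateAt P N C k a Cst s δA δ₁ (P.mesh 0 ^ P.d * Cst) (cK1 P C k Cst s) M := by
    rw [rateAt_closed]
    exact div_le_div_of_nonneg_left hδ₁.le (pow_pos h4L0 _) (pow_le_pow_right₀ h4L (Nat.le_succ M))
  have hδmix : δ ≤ rateAt P N C k a Cst s δA (dipRate P δ₁) (cvDip P N C k a δ₁ Cst CM s δA) (cdDip P N C k a δ₁ Cst CM s δA)
      (M - 1) := by
    rw [mixRate_eq, hM12]
  -- scale factors and geometry
  have hmk : 0 ≤ P.mesh k := (P.mesh_pos k).le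
  have hpowM : P.mesh k ^ M ≤ (eR * pR) ^ M := pow_le_pow_left₀ hmk ht M
  have heM : 0 ≤ P.mesh k ^ M := pow_nonneg hmk M
  have hG2 : 0 ≤ P.mesh k ^ 2 * (P.mesh k ^ P.d)⁻¹ := by positivity
  have hG1 : 0 ≤ P.mesh k * (P.mesh k ^ P.d)⁻¹ := by positivity
  have hG0 : 0 ≤ (P.mesh k ^ P.d)⁻¹ := by positivity
  have hGH : 0 ≤ P.mesh k * (P.mesh k ^ P.d)⁻¹ * (P.mesh k ^ α)⁻¹ := by
    have := Real.rpow_nonneg hmk α; positivity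
  have hLk : (0 : ℝ) < (P.L : ℝ) ^ k := by positivity
  have htd : ∀ x x' : HiggsLattice.Site P 0, (0 : ℝ) ≤ (HiggsLattice.Site.tdist x x' : ℝ) / (P.L : ℝ) ^ k :=
    fun x x' => div_nonneg (Nat.cast_nonneg _) hLk.le
  have htdH : ∀ x₁ x₂ x' : HiggsLattice.Site P 0,
      (0 : ℝ) ≤ min (HiggsLattice.Site.tdist x₁ x' : ℝ) (HiggsLattice.Site.tdist x₂ x' : ℝ) / (P.L : ℝ) ^ k :=
    fun x₁ x₂ x' => div_nonneg (le_min (Nat.cast_nonneg _) (Nat.cast_nonneg _)) hLk.le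
  have hq : ∀ x₁ x₂ : HiggsLattice.Site P 0, (0 : ℝ) ≤ (P.mesh 0 * (HiggsLattice.Site.tdist x₁ x₂ : ℝ)) ^ α :=
    fun x₁ x₂ => Real.rpow_nonneg (mul_nonneg (P.mesh_pos 0).le (Nat.cast_nonneg _)) α
  refine ineq25At_op116_smooth_of_bounds hL2 hk hkK hΩ (m₁ + 1) (m₂ + 1) hα0 hα1.le hc₁ hc₂ ht0 hCG hδ0 hCV hCD hCH hCM' hδG
    ?_ ?_ ?_ ?_ ?_ ?_ ?_ ?_
  · -- hV ← kernel116_value_le_region (n, n′)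
    intro x x' hx hx'
    have h := kernel116_value_le_region hδ₁ hδ₁1 hCst h210B h210AB hmsq ha hk hkK i₀ hs hA hδA hregA hAS (m₁ + 1) (m₂ + 1) hdV x x'
      hx hx'
    exact h.trans (entry_mono hCV heM hpowM hG2 hδU (htd x x'))
  · -- hV′ ← kernel116_value_le_region (n′, n)
    intro x x' hx hx'
    have h := kernel116_value_le_region hδ₁ hδ₁1 hCst h210B h210AB hmsq ha hk hkK i₀ hs hA hδA hregA hAS (m₂ + 1) (m₁ + 1) hdV' x x'
      hx hx'
    rw [show m₂ + 1 + (m₁ + 1) = M by omega] at h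
    exact h.trans (entry_mono hCV heM hpowM hG2 hδU (htd x x'))
  · -- hDv ← kernel116_deriv_le_region (n, n′)
    intro μ x x' hx hx'
    have h := kernel116_deriv_le_region hδ₁ hδ₁1 hCst h210B h210AB hmsq ha hk hkK i₀ hs hA hδA hregA hAS (m₁ + 1) (m₂ + 1) hdD μ x x'
      hx hx'
    exact h.trans (entry_mono hCD heM hpowM hG1 hδU (htd x x'))
  · -- hDv′ ← kernel116_deriv_le_region (n′, n)
    intro μ x x' hx hx'
    have h := kernel116_deriv_le_region hδ₁ hδ₁1 hCst h210B h210AB hmsq ha hk hkK i₀ hs hA hδA hregA hAS (m₂ + 1) (m₁ + 1) hdD' μ x x'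
      hx hx'
    rw [show m₂ + 1 + (m₁ + 1) = M by omega] at h
    exact h.trans (entry_mono hCD heM hpowM hG1 hδU (htd x x'))
  · -- hH ← kernel116_holder_le_region_of_state (n − 1, n′), the inner fields in the region state of R2
    intro μ x₁ x₂ x' Γ hx₁ hx₂ hx' hne hΓ
    have h := kernel116_holder_le_region_of_state hδ₁ hδ₁1 hCst hk hkK i₀ hs hA hδA hregA hAS hα1 hcH h211 hL m₁ (m₂ + 1) hdH μ
      x₁ x₂ x' hx₁ hx₂ hne Γ hΓ
      (fun i' => state_op116_cb_region hδ₁ hδ₁1 hCst h210B h210AB hmsq ha hk hkK i₀ hs hA hδA hregA hAS hx' m₁ (m₂ + 1) i')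
    rw [← hM1] at h
    exact h.trans (entry_mono_holder (hq x₁ x₂) hCH heM hpowM hGH hδU (htdH x₁ x₂ x'))
  · -- hH′ ← kernel116_holder_le_region_of_state (n′ − 1, n)
    intro μ x₁ x₂ x' Γ hx₁ hx₂ hx' hne hΓ
    have h := kernel116_holder_le_region_of_state hδ₁ hδ₁1 hCst hk hkK i₀ hs hA hδA hregA hAS hα1 hcH h211 hL m₂ (m₁ + 1) hdH' μ
      x₁ x₂ x' hx₁ hx₂ hne Γ hΓ
      (fun i' => state_op116_cb_region hδ₁ hδ₁1 hCst h210B h210AB hmsq ha hk hkK i₀ hs hA hδA hregA hAS hx' m₂ (m₁ + 1) i')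
    rw [show m₂ + (m₁ + 1) = M - 1 by omega] at h
    exact h.trans (entry_mono_holder (hq x₁ x₂) hCH heM hpowM hGH hδU (htdH x₁ x₂ x'))
  · -- hM ← kernel116_mixed_le_region (n, n′)
    intro μ ν x x' hx hx'
    have h := kernel116_mixed_le_region hδ₁ hδ₁1 hCst hCM h210B hmixB h210AB hmixAB hmsq ha hk hkK i₀ hs hA hδA hregA hAS ht1 (m₁ + 1)
      (m₂ + 1) hd μ ν hx hx'
    exact h.trans (entry_mono hCM' heM hpowM hG0 hδmix (htd x x'))
  · -- hM′ ← kernel116_mixed_le_region (n′, n)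
    intro μ ν x x' hx hx'
    have h := kernel116_mixed_le_region hδ₁ hδ₁1 hCst hCM h210B hmixB h210AB hmixAB hmsq ha hk hkK i₀ hs hA hδA hregA hAS ht1 (m₂ + 1)
      (m₁ + 1) hd' μ ν hx hx'
    rw [show m₂ + 1 + (m₁ + 1) = M by omega] at h
    exact h.trans (entry_mono hCM' heM hpowM hG0 hδmix (htd x x'))

end Main

/-! ## §2 (2.5), the (1.16) alternative, on a region — hypothesis-free under print's regime -/

section Plug

/-- rate weakening of a decay factor `exp(−ρ·t)`. [cite: Balaban1983Higgs3, (2.10) p.426] -/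
private theorem exp_rate_mono {ρ ρ' t : ℝ} (h : ρ' ≤ ρ) (ht : 0 ≤ t) : Real.exp (-(ρ * t)) ≤ Real.exp (-(ρ' * t)) :=
  Real.exp_le_exp.mpr (by nlinarith)

/-- rate weakening of `exp(−ρ·u·s)`, `u, s ≥ 0`. [cite: Balaban1983Higgs3, (2.10) p.426] -/
private theorem exp_rate_mono3 {ρ ρ' u s : ℝ} (h : ρ' ≤ ρ) (hu : 0 ≤ u) (hs : 0 ≤ s) :
    Real.exp (-(ρ * u * s)) ≤ Real.exp (-(ρ' * u * s)) := by
  apply Real.exp_le_exp.mpr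
  have := mul_le_mul_of_nonneg_right (mul_le_mul_of_nonneg_right h hu) hs
  linarith

set_option maxHeartbeats 800000 in
/-- **INEQUALITY (2.5) OF [B3], THE (1.16) ALTERNATIVE, ON A REGION, UNDER PRINT'S REGIME ONLY** — all orders `n, n′ ≥ 1` with `n + n′ > d`,
every Hölder index `0 ≤ α < 1`, every pair of nested big-block unions `Ω₂ ⊆ Ω ⊆ T_ε`.  For `d ≥ 1`, `L ≥ 2`, `a > 0`, `m² > 0`, a regularity
budget `c ≥ 0`, support size `m`, bump constants `c₁, c₂ ≥ 0`: ∃ charge threshold `E₀ > 0`, ∀ charge data with `e² ≤ E₀`, ∃ `K₀min`, ∀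
`0 ≤ α < 1`, ∀ `K₀ ≥ K₀min`, ∃ `t > 0`, `0 < δ₁ ≤ 1`, `δ₀ > 0`, `C, C_M, C_H, C_G ≥ 0`, such that on every torus `T_ε` (dimension `d`, ratio
`L`, `K₀ ∣ M`), every scale `1 ≤ k ≤ K` with `≥ 3` cubes per direction and `L^kε ≤ 1`, all big-block unions `Ω₂ ⊆ Ω`, all backgrounds
`Ã, B̃` with `B̃`, `Ã+B̃` (I.2.23)-regular ON `Ω` (`δ_B, δ_{AB} ≥ 0`), `Ã` (I.2.23)-regular (`δ_A ≥ 0`), `L^kδ_B|e| ≤ t`, `L^kδ_{AB}|e| ≤ t`,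
`L^kδ_B ≤ c|e|`, `sup_b|Ã_b| ≤ s` (`s ≥ 0`), `(L^kε)|e|s ≤ 1`, AND `Ã` SUPPORTED ON DEEP BONDS OF `Ω` (print p. 412 «dist(supp Ã, ∂Ω) >
2r(L^kε)»: `Ã_b ≠ 0 ⇒ DeepBlk b₋ ∧ DeepBlk b₊`), every margin `r₀` and carrier parameters `0 ≤ e_Rp_R`, `L^kε ≤ e_Rp_R`:
`(sect2Smooth116 hP1 C Ω Ω₂ A B …).Ineq25At n n′ α (min δ₀ (δ₁/(4L)^{n+n′+1})) (C_G + K(c₁,c₂+2c₁,d,m)·(valC(n+n′)+derC(n+n′)) +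
holC(…ε^dC_H…)(n+n′−1) + d·m·mixC(n+n′))` — i.e. `‖hδG_k(Ω,Ω₂,B̃)h′‖_{1,α}` AND `‖h(1.16)^Ω_{n,n′}h′‖_{1,α} ≤ C·(e_Rp_R)^{n+n′}e^{−δdist(supp h,supp h′)}`
for all smooth localization functions of the carrier.  R5(B) `ineq25At_op116_regularRegion` with its inputs discharged by
`ineq210_regularRegion_small` ((2.10) for `B̃` and `Ã+B̃` on `Ω`), `ineq210_mixed_regularRegion`, `hcol_le_region` ((2.11)),
`ineq25_smooth_regularNested` (`δG_k`), at a common cube size and a common rate.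
[cite: Balaban1983Higgs3, (2.5) p.424, (1.16) p.414, p.412, (1.32) p.420, (2.10)-(2.11) p.426] [cite: Balaban1982Higgs1, Prop. 2.1 (2.23)-(2.25) p.610, (3.44) p.619] [cite: Balaban1983RegularityDecay, Theorem p.573] -/
theorem ineq25At_op116_region (d L : ℕ) (hd : 1 ≤ d) (hL : 2 ≤ L) {a : ℝ} (ha : 0 < a) {msq : ℝ} (hmsq : 0 < msq)
    {c : ℝ} (hc : 0 ≤ c) (N m : ℕ) {c₁ c₂ : ℝ} (hc₁ : 0 ≤ c₁) (hc₂ : 0 ≤ c₂)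
    (n n' : ℕ) (hn : 1 ≤ n) (hn' : 1 ≤ n') (hdn : d < n + n') :
    ∃ E₀ : ℝ, 0 < E₀ ∧ ∀ (C : ChargeData N), C.e ^ 2 ≤ E₀ →
      ∃ K₀min : ℕ, ∀ {α : ℝ}, 0 ≤ α → α < 1 → ∀ K₀ : ℕ, K₀min ≤ K₀ →
      ∃ t δ₁ δ₀ Cst CM CH CG : ℝ, 0 < t ∧ 0 < δ₁ ∧ δ₁ ≤ 1 ∧ 0 < δ₀ ∧ 0 ≤ Cst ∧ 0 ≤ CM ∧ 0 ≤ CH ∧ 0 ≤ CG ∧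
      ∀ (P : HiggsLattice.Params) (hP1 : 1 < P.L), P.d = d → P.L = L → K₀ ∣ P.M →
      ∀ {k : ℕ}, 1 ≤ k → k ≤ P.K → (∀ μ, 3 * half P k K₀ ≤ P.sitesPerDir 0 μ) → P.mesh k ≤ 1 →
      ∀ (Ω Ω₂ : Finset (HiggsLattice.Site P 0)), IsBigBlockUnion k K₀ Ω → IsBigBlockUnion k K₀ Ω₂ → Ω₂ ⊆ Ω →
      ∀ (A B : HiggsLattice.VecField P 0) {δB δAB δA s : ℝ}, 0 ≤ δB → 0 ≤ δAB → 0 ≤ δA → 0 ≤ s →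
        (∀ z ∈ Ω, ∀ μ ν : Fin P.d, |B ⟨z.shift ν, μ⟩ - B ⟨z, μ⟩| ≤ δB) →
        (∀ z ∈ Ω, ∀ μ ν : Fin P.d, |(A + B) ⟨z.shift ν, μ⟩ - (A + B) ⟨z, μ⟩| ≤ δAB) →
        (∀ (z : HiggsLattice.Site P 0) (μ ν : Fin P.d), |A ⟨z.shift ν, μ⟩ - A ⟨z, μ⟩| ≤ δA) →
        (P.L : ℝ) ^ k * δB * |C.e| ≤ t → (P.L : ℝ) ^ k * δAB * |C.e| ≤ t → (P.L : ℝ) ^ k * δB ≤ c * |C.e| →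
        (∀ b : HiggsLattice.PBond P 0, |A b| ≤ s) → P.mesh k * (|C.e| * s) ≤ 1 →
        (∀ b : HiggsLattice.PBond P 0, A b ≠ 0 → DeepBlk k K₀ Ω b.src ∧ DeepBlk k K₀ Ω b.tgt) →
      ∀ (r₀ : ℕ) {eR pR : ℝ}, 0 ≤ eR * pR → P.mesh k ≤ eR * pR → Ix N →
        (sect2Smooth116 hP1 C Ω Ω₂ A B msq a k K₀ r₀ m c₁ c₂ eR pR).Ineq25At n n' α
          (min δ₀ (δ₁ / (4 * (P.L : ℝ)) ^ (n + n' + 1)))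
          (CG + (smoothConst P.d m c₁ (c₂ + 2 * c₁) *
              (valC P N C k a δ₁ Cst s δA (n + n') + derC P N C k a δ₁ Cst s δA (n + n'))
            + (holC P N C k a δ₁ Cst s δA α (P.mesh 0 ^ P.d * CH) (n + n' - 1)
              + P.d * m * mixC P N C k a δ₁ Cst CM s δA (n + n')))) := by
  obtain ⟨E₀, hE₀, hG⟩ := ineq25_smooth_regularNested d L hd hL ha hmsq hc N m hc₁ hc₂
  refine ⟨E₀, hE₀, fun C heC => ?_⟩
  obtain ⟨K₄, hK₄⟩ := hG C heC
  obtain ⟨K₁, hK₁⟩ := ineq210_regularRegion_small d L hd hL ha hmsq N C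
  obtain ⟨K₂, hK₂⟩ := ineq210_mixed_regularRegion d L hd hL ha hmsq N C
  obtain ⟨K₃, hK₃⟩ := hcol_le_region d L hd hL ha hmsq N C
  refine ⟨max (max K₁ K₂) (max K₃ K₄), fun {α} hα0 hα1 K₀ hK₀ => ?_⟩
  obtain ⟨t₁, δ₁, C₁, ht₁, hδ₁, hC₁, h1⟩ := hK₁ K₀ ((le_max_left K₁ K₂).trans ((le_max_left _ _).trans hK₀))
  obtain ⟨t₂, δ₂, C₂, ht₂, hδ₂, hC₂, h2⟩ := hK₂ K₀ ((le_max_right K₁ K₂).trans ((le_max_left _ _).trans hK₀))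
  obtain ⟨t₃, δ₃, C₃, ht₃, hδ₃, hC₃, h3⟩ := hK₃ hα0 hα1 K₀ ((le_max_left K₃ K₄).trans ((le_max_right _ _).trans hK₀))
  obtain ⟨t₄, δ₄, C₄, ht₄, hδ₄, hC₄, h4⟩ := hK₄ hα0 hα1 K₀ ((le_max_right K₃ K₄).trans ((le_max_right _ _).trans hK₀))
  -- the common smallness threshold and the common rate
  set t : ℝ := min (min t₁ t₂) (min t₃ t₄) with htdef
  set δ : ℝ := min (min δ₁ δ₂) (min δ₃ 1) with hδdef
  have htt₁ : t ≤ t₁ := (min_le_left _ _).trans (min_le_left _ _)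
  have htt₂ : t ≤ t₂ := (min_le_left _ _).trans (min_le_right _ _)
  have htt₃ : t ≤ t₃ := (min_le_right _ _).trans (min_le_left _ _)
  have htt₄ : t ≤ t₄ := (min_le_right _ _).trans (min_le_right _ _)
  have hδδ₁ : δ ≤ δ₁ := (min_le_left _ _).trans (min_le_left _ _)
  have hδδ₂ : δ ≤ δ₂ := (min_le_left _ _).trans (min_le_right _ _)
  have hδδ₃ : δ ≤ δ₃ := (min_le_right _ _).trans (min_le_left _ _)
  have hδ1 : δ ≤ 1 := (min_le_right _ _).trans (min_le_right _ _)
  have hδ0 : 0 < δ := lt_min (lt_min hδ₁ hδ₂) (lt_min hδ₃ one_pos)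
  refine ⟨t, δ, δ₄, C₁, C₂, C₃, C₄, lt_min (lt_min ht₁ ht₂) (lt_min ht₃ ht₄), hδ0, hδ1, hδ₄, hC₁.le, hC₂.le, hC₃.le, hC₄.le, ?_⟩
  intro P hP1 hPd hPL hK₀M k hk hkK h3h hmesh Ω Ω₂ hΩ hΩ₂ hsub A B δB δAB δA s hδB hδAB hδA hs hregB hregAB hregA htB htAB hcB hA ht1
    hAS r₀ eR pR ht0 ht i₀
  have hL2 : 2 ≤ P.L := by rw [hPL]; exact hL
  have hdP : P.d < n + n' := by rw [hPd]; exact hdn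
  have hε := P.mesh_pos 0
  -- (2.10) for `B̃` and `Ã+B̃` on `Ω` at the common rate
  have h210B : (regRegionKernels hP1 C Ω B msq a k K₀).Ineq210 δ C₁ :=
    ineq210_rate_mono hC₁.le hδδ₁ (h1 P hP1 hPd hPL hK₀M hk hkK h3h hmesh Ω hΩ B hδB hregB (htB.trans htt₁))
  have h210AB : (regRegionKernels hP1 C Ω (A + B) msq a k K₀).Ineq210 δ C₁ :=
    ineq210_rate_mono hC₁.le hδδ₁ (h1 P hP1 hPd hPL hK₀M hk hkK h3h hmesh Ω hΩ (A + B) hδAB hregAB (htAB.trans htt₁))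
  -- the twice-differentiated per-piece (2.10) on `Ω` at the common rate
  have hLj : ∀ j : ℕ, (0 : ℝ) < (P.L : ℝ) ^ j := fun j => by have := P.hL; positivity
  have hmix : ∀ (X : HiggsLattice.VecField P 0) {δX : ℝ}, 0 ≤ δX →
      (∀ z ∈ Ω, ∀ μ ν : Fin P.d, |X ⟨z.shift ν, μ⟩ - X ⟨z, μ⟩| ≤ δX) → (P.L : ℝ) ^ k * δX * |C.e| ≤ t →
      ∀ (j : ℕ) (μ ν : Fin P.d) (x x' : HiggsLattice.Site P 0), Interior k K₀ Ω x → Interior k K₀ Ω x' →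
        mixedTermR C Ω X msq a k j μ ν x x'
          ≤ C₂ * (P.mesh j ^ P.d)⁻¹ * Real.exp (-(δ * ((HiggsLattice.Site.tdist x x' : ℝ) / (P.L : ℝ) ^ j))) := by
    intro X δX hδX hregX htX j μ ν x x' hx hx'
    refine (h2 P hPd hPL hK₀M hk hkK h3h hmesh Ω hΩ X hδX hregX (htX.trans htt₂) j μ ν x x' hx hx').trans ?_
    exact mul_le_mul_of_nonneg_left (exp_rate_mono hδδ₂ (div_nonneg (Nat.cast_nonneg _) (hLj j).le))
      (mul_nonneg hC₂.le (inv_nonneg.mpr (pow_nonneg (P.mesh_pos j).le _)))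
  have hmixB := hmix B hδB hregB htB
  have hmixAB := hmix (A + B) hδAB hregAB htAB
  -- the (2.11) Hölder row of `G_k(Ω,B̃)` at interior points at the common rate
  have h211 : ∀ (μ : Fin P.d) (x₁ x₂ y : HiggsLattice.Site P 0), Interior k K₀ Ω x₁ → Interior k K₀ Ω x₂ → Interior k K₀ Ω y →
      x₁ ≠ x₂ → ∀ Γ : List (HiggsLattice.Site P 0), IsAdm x₁ x₂ Γ →
      (∑ i : Ix N, ‖hol C B x₁ Γ (covDeriv C B (propagatorK C Ω B msq a k (cb P N 0 (y, i))) ⟨x₂, μ⟩)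
          - covDeriv C B (propagatorK C Ω B msq a k (cb P N 0 (y, i))) ⟨x₁, μ⟩‖)
          / (P.mesh 0 * (HiggsLattice.Site.tdist x₁ x₂ : ℝ)) ^ α
        ≤ ∑ j ∈ Finset.range k, (P.mesh 0 ^ P.d * C₃) * P.mesh j ^ (((1 : ℝ) - α) - (P.d : ℝ)) *
            (Real.exp (-(δ * (P.mesh j)⁻¹ * (P.mesh 0 * (HiggsLattice.Site.tdist x₁ y : ℝ)))) +
              Real.exp (-(δ * (P.mesh j)⁻¹ * (P.mesh 0 * (HiggsLattice.Site.tdist x₂ y : ℝ))))) := by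
    intro μ x₁ x₂ y hx₁ hx₂ hy hne Γ hΓ
    refine (h3 P hP1 hPd hPL hK₀M hk hkK h3h hmesh Ω hΩ B hδB hregB (htB.trans htt₃) μ x₁ x₂ y hx₁ hx₂ hy hne Γ hΓ).trans ?_
    refine Finset.sum_le_sum fun j _ => ?_
    have hcj : 0 ≤ (P.mesh 0 ^ P.d * C₃) * P.mesh j ^ (((1 : ℝ) - α) - (P.d : ℝ)) :=
      mul_nonneg (mul_nonneg (pow_nonneg hε.le _) hC₃.le) (Real.rpow_nonneg (P.mesh_pos j).le _)
    refine mul_le_mul_of_nonneg_left (add_le_add ?_ ?_) hcj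
    · exact exp_rate_mono3 hδδ₃ (inv_nonneg.mpr (P.mesh_pos j).le) (mul_nonneg hε.le (Nat.cast_nonneg _))
    · exact exp_rate_mono3 hδδ₃ (inv_nonneg.mpr (P.mesh_pos j).le) (mul_nonneg hε.le (Nat.cast_nonneg _))
  -- the `δG_k(Ω,Ω₂,B̃)` clause with smooth localizations
  have hδG : (sect2DeltaSmooth hP1 C Ω Ω₂ B msq a k K₀ r₀ m c₁ c₂).Ineq25 α δ₄ C₄ :=
    h4 P hP1 hPd hPL hK₀M hk hkK h3h hmesh Ω Ω₂ hΩ hΩ₂ hsub B hδB hregB (htB.trans htt₄) hcB r₀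
  exact ineq25At_op116_regularRegion hL2 hk hkK hmsq ha hsub n n' hn hn' hdP hα0 hα1 hc₁ hc₂ ht0 ht hC₄.le hδG hδ0 hδ1 hC₁.le hC₂.le
    h210B hmixB h210AB hmixAB i₀ hs hA hδA hregA hAS ht1 (mul_nonneg (pow_nonneg hε.le _) hC₃.le) h211

end Plug

end Literature.MathematicalPhysics.QuantumFieldTheory.Balaban1983to89.B3Ineq25Op116RegularRegion

end
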